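import Literature.Analysis.FluidPDE.SuitableWeak
import HarnessLib

/-!
# Local Leray solutions (Lemarié-Rieusset; Jia–Šverák 2014, §3; Kang–Miura–Tsai 2021, Def. 3.2)

Analysis/FluidPDE definition file. Lemarié-Rieusset's *local Leray solutions* (weak solutions
of the Navier–Stokes equations with uniformly locally square integrable data, *Recent
developments in the Navier–Stokes problem* (2002), Ch. 32–33; *The Navier–Stokes problem in the
21st century* (2016), Def. 14.1) are the global-in-space, infinite-energy analogue of Leray–Hopf
solutions. They are the "Leray solutions `NS(u₀)`" of Rusin–Šverák (J. Funct. Anal. 260 (2011),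
§4) and the "Leray solutions `𝒩(u₀)`" of Jia–Šverák (Invent. Math. 196 (2014), §3), and the
"local energy solutions" of Kikuchi–Seregin (2007) and Bradshaw–Tsai. Three slightly different
axiomatics are in print (Lemarié-Rieusset: the projected equation `∂ₜu = Δu - ℙ∇·(u ⊗ u)`;
Kikuchi–Seregin: an explicit local pressure expansion; Jia–Šverák: a decay condition at spatial
infinity); Kang–Miura–Tsai (IMRN 2021, §3, Def. 3.1, Def. 3.2, Lemmas 3.3–3.4) state the last
two side by side and prove them equivalent. This file vendors **Jia–Šverák's definition in the
form printed by Kang–Miura–Tsai, Def. 3.2** ("local Leray solution"), over the tree's notions of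
suitable weak solution (`IsSuitableWeakSolutionOn`, CKN 1982) and weak spatial gradient
(`HasWeakSpatialGradientOn`):

> (KMT Def. 3.1/3.2, JS §3 Def. of `𝒩(u₀)`.) A vector field `v ∈ L²_loc(ℝ³ × [0,∞))` is a local
> Leray solution to (NS) with divergence free initial data `v₀ ∈ E²` if: (1) for some
> `π ∈ L^{3/2}_loc(ℝ³ × [0,∞))`, the pair `(v, π)` is a distributional solution to (NS); (2) for
> any `R > 0`, `esssup_{0 ≤ t < R²} sup_{x₀ ∈ ℝ³} ∫_{B_R(x₀)} |v(x,t)|² dx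
> + sup_{x₀ ∈ ℝ³} ∫₀^{R²} ∫_{B_R(x₀)} |∇v(x,t)|² dx dt < ∞`; (3) for all compact subsets `K` of `ℝ³`
> we have `v(t) → v₀` in `L²(K)` as `t → 0⁺`; (4) `v` is suitable in the sense of
> Caffarelli–Kohn–Nirenberg [local energy inequality for all non-negative
> `φ ∈ C_c^∞(Q)`, `Q ⋐ ℝ³ × (0,∞)`]; (7) for any `R > 0`,
> `lim_{|x₀| → ∞} ∫₀^{R²} ∫_{B_R(x₀)} |v(x,t)|² dx dt = 0`.

as the structure `IsLocalLeraySolution ν v₀ v π` (viscosity `ν`, no force; the sources have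
`ν = 1`). Rusin–Šverák's set `NS(u₀)` of Leray solutions with an `Ḣ^{1/2}` datum (§4 p. 6: "we
can construct a global weak solution `u` to the Cauchy problem with `u₀ ∈ Ḣ^{1/2}` [...] `(u,p)`
is a suitable weak solution in `ℝ³ × (0,∞)` and `u(t) → u₀` in `L²` on every compact subset of
`ℝ³`. The weak solution `u` with these properties will be called the Leray solution"; their
Lemma 4.1 and Thm. 4.1 are Lemarié-Rieusset's a priori estimate and weak–strong uniqueness for
this class, and Jia–Šverák §3 records that these estimates "played an important role in
[Rusin–Šverák]") is `{u | ∃ p, IsLocalLeraySolution 1 u₀ u p}`.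

Also proved: the projections to the tree's notions and **non-vacuity** — the trivial flow
`(v, π) = (0, 0)` is a local Leray solution with datum `0` (`isLocalLeraySolution_zero`).

## Design notes

* *(1)+(4) = suitability on the open slab.* `IsSuitableWeakSolutionOn (slab ℝ³ (Ioi 0)) ν 0 v π`
  is exactly "distributional solution on `ℝ³ × (0,∞)` with `v ∈ L^∞_t L²_x ∩ L²_t Ḣ¹_x` and
  `π ∈ L^{3/2}` locally on the open slab, plus the integrated CKN inequality
  `2ν ∫∫ |∇v|²φ ≤ ∫∫ |v|²(φₜ + νΔφ) + (|v|² + 2π) v·∇φ` for `0 ≤ φ ∈ C_c^∞(ℝ³ × (0,∞))`"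
  (Jia–Šverák's (iii) verbatim; KMT print the time-sliced form, which integrates to this one and
  follows from it for a.e. slice). KMT's `π ∈ L^{3/2}_loc(ℝ³ × [0,∞))` and
  `v ∈ L²_loc(ℝ³ × [0,∞))` are integrability *up to `t = 0`*, recorded separately (`pressure`,
  `sqIntegrable`; measurability on the slab comes with the distributional solution).
* *(2)* The `esssup_t sup_{x₀}` bound is "`∀ᵐ t ∈ (0,R²), ∀ x₀, ∫_{B_R(x₀)} |v(t)|² ≤ C`"; the
  gradient is a weak spatial gradient `G` of `v` on the slab (`HasWeakSpatialGradientOn`; unique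
  a.e.), one `G` serving all radii, measured by the Frobenius norm `frobeniusNormSq`.
* *(7)* `x₀ → ∞` is Mathlib's `Filter.cocompact ℝ³`.
* The datum's standing hypotheses (`v₀ ∈ E²`, `div v₀ = 0`) are **not** bundled: theorems state
  them. KMT's property (6) (weak continuity in time) and the pressure expansion (5) belong to
  Def. 3.1, not to Def. 3.2, and are consequences (KMT Lemma 3.4, "stated in [Jia–Šverák]
  without a proof"); they are not fields here.

## Mathlib / tree search

Tree: no `L²_uloc` / local-Leray notion (`lean search 'uloc|LocalLeray|LocalEnergySol'`: none);
ad hoc renderings of neighbouring classes exist inside single facts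
(`bradshawTsai2019_dss_existence`, `chaeWolf2018_dss_existence`, `SelfSimilarLiouville.lean`).
Reused: `IsSuitableWeakSolutionOn`, `HasWeakSpatialGradientOn`, `frobeniusNormSq`, `slab`
(`SuitableWeak.lean`, `WeakSolution.lean`).

## References

* H. Jia, V. Šverák, *Local-in-space estimates near initial time for weak solutions of the
  Navier–Stokes equations and forward self-similar solutions*, Invent. Math. 196 (2014) 233–265
  = arXiv:1204.0529, §3 (definition of Leray solutions `𝒩(u₀)`; Lemma on the a priori estimate).
* K. Kang, H. Miura, T.-P. Tsai, *Short time regularity of Navier–Stokes flows with locally `L³`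
  initial data and applications*, IMRN 2021 (11) 8763–8805 = arXiv:1812.10509, §3: Def. 3.1,
  Def. 3.2, Lemmas 3.3–3.4.
* P. G. Lemarié-Rieusset, *The Navier–Stokes problem in the 21st century* (2016), Def. 14.1,
  Thm. 14.2.
* W. Rusin, V. Šverák, J. Funct. Anal. 260 (2011) = arXiv:0911.0500, §4 p. 6 (Leray solutions
  `NS(u₀)`), Lemma 4.1, Thm. 4.1.
* L. Caffarelli, R. Kohn, L. Nirenberg, CPAM 35 (1982), §2.
-/

noncomputable section

open MeasureTheory TopologicalSpace Set Function Filter Topology Metric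
open scoped ENNReal NNReal RealInnerProductSpace

namespace Literature.Analysis.FluidPDE

local notation "ℝ³" => EuclideanSpace ℝ (Fin 3)

/-- **Local Leray solutions** (Jia–Šverák, Invent. Math. 196 (2014), §3, "Leray solution",
the set `𝒩(u₀)`; Kang–Miura–Tsai, IMRN 2021, **Def. 3.2** "local Leray solution"; the class of
Lemarié-Rieusset 2002/2016 Def. 14.1 and of Rusin–Šverák's `NS(u₀)`, 2011 §4). `v` is a local
Leray solution of the unforced Navier–Stokes equations with viscosity `ν` and datum `v₀` on
`ℝ³ × (0, ∞)`: (1)+(4) `(v, π)` is a suitable weak solution on the open slab `(0,∞) × ℝ³`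
(distributional solution, local energy class, `π ∈ L^{3/2}_loc`, CKN local energy inequality);
`v ∈ L²_loc` and `π ∈ L^{3/2}_loc` up to `t = 0`; (2) for every `R > 0` the uniformly local
energy `esssup_{0<t<R²} sup_{x₀} ∫_{B_R(x₀)} |v(t)|²` and `sup_{x₀} ∫₀^{R²}∫_{B_R(x₀)} |∇v|²` are
finite (`∇v` = a weak spatial gradient `G` on the slab); (3) `v(t) → v₀` in `L²(K)` for every
compact `K` as `t → 0⁺`; (7) `∫₀^{R²}∫_{B_R(x₀)} |v|² → 0` as `|x₀| → ∞`, for every `R > 0`. The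
hypotheses `v₀ ∈ E²`, `div v₀ = 0` on the datum are not bundled (see the module docstring for
the design notes). [cite: KangMiuraTsai2020, Def. 3.2 (with Def. 3.1); = JiaSverak2014 §3] -/
structure IsLocalLeraySolution (ν : ℝ) (v₀ : ℝ³ → ℝ³) (v : ℝ → ℝ³ → ℝ³) (π : ℝ → ℝ³ → ℝ) :
    Prop where
  /-- (1)+(4): `(v, π)` is a suitable weak solution (CKN) of the unforced equations on the open
  slab `(0, ∞) × ℝ³`. -/
  suitable : IsSuitableWeakSolutionOn (slab ℝ³ (Ioi 0) isOpen_Ioi) ν 0 v π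
  /-- `v ∈ L²_loc(ℝ³ × [0, ∞))`: square integrable on `(0, T) × K`, `K` compact (up to `t = 0`). -/
  sqIntegrable : ∀ T : ℝ, 0 < T → ∀ K : Set ℝ³, IsCompact K →
    ∫⁻ z in Ioo 0 T ×ˢ K, ‖v z.1 z.2‖ₑ ^ 2 < ∞
  /-- (1): `π ∈ L^{3/2}_loc(ℝ³ × [0, ∞))` (up to `t = 0`). -/
  pressure : ∀ T : ℝ, 0 < T → ∀ K : Set ℝ³, IsCompact K →
    ∫⁻ z in Ioo 0 T ×ˢ K, ‖π z.1 z.2‖ₑ ^ (3 / 2 : ℝ) < ∞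
  /-- (2), first half: `esssup_{0 < t < R²} sup_{x₀} ∫_{B_R(x₀)} |v(x,t)|² dx < ∞` for every `R > 0`. -/
  uniformLocalEnergy : ∀ R : ℝ, 0 < R → ∃ C : ℝ≥0,
    ∀ᵐ t ∂(volume.restrict (Ioo 0 (R ^ 2))), ∀ x₀ : ℝ³, ∫⁻ x in ball x₀ R, ‖v t x‖ₑ ^ 2 ≤ C
  /-- (2), second half: `v` has a weak spatial gradient `G = ∇v` on the slab with
  `sup_{x₀} ∫₀^{R²} ∫_{B_R(x₀)} |∇v|² dx dt < ∞` for every `R > 0`. -/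
  uniformLocalGradient : ∃ G : ℝ → ℝ³ → ℝ³ →L[ℝ] ℝ³,
    HasWeakSpatialGradientOn (slab ℝ³ (Ioi 0) isOpen_Ioi) v G ∧
    ∀ R : ℝ, 0 < R → ∃ C : ℝ≥0, ∀ x₀ : ℝ³,
      ∫⁻ z in Ioo 0 (R ^ 2) ×ˢ ball x₀ R, ENNReal.ofReal (frobeniusNormSq (G z.1 z.2)) ≤ C
  /-- (3): the datum is attained in `L²_loc`: `∫_K |v(t) - v₀|² → 0` as `t → 0⁺`, `K` compact. -/
  initial : ∀ K : Set ℝ³, IsCompact K →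
    Tendsto (fun t => ∫⁻ x in K, ‖v t x - v₀ x‖ₑ ^ 2) (𝓝[>] 0) (𝓝 0)
  /-- (7): decay at spatial infinity, `∫₀^{R²} ∫_{B_R(x₀)} |v|² → 0` as `|x₀| → ∞`, `R > 0`. -/
  decay : ∀ R : ℝ, 0 < R →
    Tendsto (fun x₀ : ℝ³ => ∫⁻ z in Ioo 0 (R ^ 2) ×ˢ ball x₀ R, ‖v z.1 z.2‖ₑ ^ 2)
      (cocompact ℝ³) (𝓝 0)

namespace IsLocalLeraySolution

variable {ν : ℝ} {v₀ : ℝ³ → ℝ³} {v : ℝ → ℝ³ → ℝ³} {π : ℝ → ℝ³ → ℝ}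

/-- A local Leray solution is a distributional solution of Navier–Stokes on the open slab
`(0, ∞) × ℝ³` (KMT Def. 3.1 (1)). [cite: KangMiuraTsai2020, Def. 3.1 (1)] -/
theorem distributional (h : IsLocalLeraySolution ν v₀ v π) :
    IsDistributionalNSSolutionOn (slab ℝ³ (Ioi 0) isOpen_Ioi) ν 0 v π :=
  h.suitable.distributional

/-- A local Leray solution is measurable on the slab `(0, ∞) × ℝ³` (it is locally integrable
there). [folklore] -/
theorem aestronglyMeasurable (h : IsLocalLeraySolution ν v₀ v π) :
    AEStronglyMeasurable (uncurry v) (volume.restrict (Ioi (0 : ℝ) ×ˢ (univ : Set ℝ³))) :=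
  h.distributional.1.aestronglyMeasurable

/-- A local Leray solution has a weak spatial gradient on the slab (KMT Def. 3.1 (2)).
[cite: KangMiuraTsai2020, Def. 3.1 (2)] -/
theorem exists_hasWeakSpatialGradientOn (h : IsLocalLeraySolution ν v₀ v π) :
    ∃ G, HasWeakSpatialGradientOn (slab ℝ³ (Ioi 0) isOpen_Ioi) v G :=
  h.uniformLocalGradient.imp fun _ hG => hG.1

end IsLocalLeraySolution

/-! ## Non-vacuity: the trivial flow -/

/-- `uncurry` of the zero field is the zero function (definitional). [folklore] -/
theorem uncurry_zero {α β γ : Type*} [Zero γ] : uncurry (0 : α → β → γ) = 0 := rfl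

/-- The zero field has the zero weak spatial gradient on any open space–time region. [folklore] -/
theorem hasWeakSpatialGradientOn_zero (Q : Opens (ℝ × ℝ³)) :
    HasWeakSpatialGradientOn Q (0 : ℝ → ℝ³ → ℝ³) (0 : ℝ → ℝ³ → ℝ³ →L[ℝ] ℝ³) := by
  refine ⟨?_, ?_, fun φ _ v w => ?_⟩
  · rw [uncurry_zero]
    exact (integrable_zero (ℝ × ℝ³) ℝ³ volume).locallyIntegrable.locallyIntegrableOn _
  · rw [uncurry_zero]
    exact (integrable_zero (ℝ × ℝ³) (ℝ³ →L[ℝ] ℝ³) volume).locallyIntegrable.locallyIntegrableOn _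
  · simp only [Pi.zero_apply, inner_zero_left, mul_zero, integral_zero, _root_.zero_apply, neg_zero]

/-- The trivial pair `(u, p) = (0, 0)` is a suitable weak solution of the unforced Navier–Stokes
system on any open space–time region (every integrand vanishes; CKN 1982 §2). [folklore] -/
theorem isSuitableWeakSolutionOn_zero (Q : Opens (ℝ × ℝ³)) (ν : ℝ) :
    IsSuitableWeakSolutionOn Q ν 0 (0 : ℝ → ℝ³ → ℝ³) (0 : ℝ → ℝ³ → ℝ) := by
  refine ⟨⟨?_, ?_, ?_, fun θ _ => ?_, fun ψ _ => ?_⟩,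
    fun K _ _ => ⟨0, Eventually.of_forall fun t => ?_⟩, fun K _ _ => ?_,
    ⟨0, hasWeakSpatialGradientOn_zero Q, fun K _ _ => ?_, fun φ _ _ => ?_⟩⟩
  · rw [uncurry_zero]
    exact (integrable_zero (ℝ × ℝ³) ℝ³ volume).locallyIntegrable.locallyIntegrableOn _
  · have : (fun z : ℝ × ℝ³ => ‖uncurry (0 : ℝ → ℝ³ → ℝ³) z‖ ^ 2) = fun _ => (0 : ℝ) := by
      ext z; simp [uncurry_zero]
    rw [this]
    exact (integrable_zero (ℝ × ℝ³) ℝ volume).locallyIntegrable.locallyIntegrableOn _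
  · rw [uncurry_zero]
    exact (integrable_zero (ℝ × ℝ³) ℝ volume).locallyIntegrable.locallyIntegrableOn _
  · simp only [Pi.zero_apply, inner_zero_left, integral_zero]
  · simp only [Pi.zero_apply, inner_zero_left, zero_mul, mul_zero, add_zero, integral_zero]
  · simp
  · simp only [Pi.zero_apply, enorm_zero]
    rw [ENNReal.zero_rpow_of_pos (by norm_num)]
    simp
  · simp [frobeniusNormSq_zero]
  · simp only [Pi.zero_apply, frobeniusNormSq_zero, zero_mul, integral_zero, mul_zero, norm_zero,
      ne_eq, OfNat.ofNat_ne_zero, not_false_eq_true, zero_pow, inner_zero_left, inner_zero_right,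
      add_zero, le_refl]

/-- **Non-vacuity.** The trivial flow `(v, π) = (0, 0)` is a local Leray solution with datum `0`
(for any viscosity): all energies vanish. [folklore] -/
theorem isLocalLeraySolution_zero (ν : ℝ) :
    IsLocalLeraySolution ν (0 : ℝ³ → ℝ³) (0 : ℝ → ℝ³ → ℝ³) (0 : ℝ → ℝ³ → ℝ) where
  suitable := isSuitableWeakSolutionOn_zero _ ν
  sqIntegrable T _ K _ := by simp
  pressure T _ K _ := by
    simp only [Pi.zero_apply, enorm_zero]
    rw [ENNReal.zero_rpow_of_pos (by norm_num)]
    simp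
  uniformLocalEnergy R _ := ⟨0, Eventually.of_forall fun t x₀ => by simp⟩
  uniformLocalGradient := ⟨0, hasWeakSpatialGradientOn_zero _, fun R _ => ⟨0, fun x₀ => by
    simp [frobeniusNormSq_zero]⟩⟩
  initial K _ := by simp
  decay R _ := by simp

end Literature.Analysis.FluidPDE
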